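import Mathlib
import HarnessLib
import Literature.Analysis.FluidPDE.LerayPressureDecayReduction
import Literature.Analysis.FluidPDE.CKNLocalEnergyEstimate
import Literature.Analysis.FluidPDE.LocalEnergySolutionsOn
import Summits.NavierStokesRegularity.NavierStokesRegularity.Theorems.QuarterLogPincerTypeIQuantSubcubicExpPressureFar

/-!
# Crux `QuarterLogPincer.TypeIQuantSubcubicExp` (stmt-NavierStokesRegularity-24077), line `thin_cascade`:
  the pressure on a time slice — uniformly local bounds LINEAR in the local energy under a pointwise
  velocity bound

Helper file (`--supports stmt-NavierStokesRegularity-24077 --as helper`, lead prover ns-tc-p1 g3) toward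
the registered 4th stub `stub_uniformScaledEnergy : UniformScaledEnergy` (skeleton v5).  The stub's
mechanism (idea-crit-7's sketch, card `Lines/thin-cascade.md`): under the Type-I rate
`‖u(t,·)‖_∞ ≤ m(t)` the flux of the local energy inequality is LINEAR in the uniformly local energy
`α(t) = sup_z ∫_{B(z,1)} |u(t)|²` with the integrable weight `m(t)`.  This file supplies the pressure
half of that statement on one time slice `w = u(t) ∈ L³(ℝ³)` with `‖w‖ ≤ m` pointwise and unit-ball
energies `≤ A`:

* `lintegral_ball_six_le` — `∫_{B(y,6)} |w|² ≤ N₆ · A` for a universal covering number `N₆`;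
* `exists_slice_pressure_bounds` — a universal `K < ∞` such that for every centre `y` there is a gauge
  `κ` with
  `∫_{B(y,3)} |Π[w] − κ| |w| ≤ K · m · A` and `∫_{B(y,3)} |Π[w] − κ|^{3/2} ≤ K · (m · A + A^{3/2})`,
  `Π[w] = rieszPressure w` the whole-space pressure.  Near field `Π[1_{B(y,6)} w]`: Hölder
  `L^{3/2} × L³` and Stein's bound `eLpNorm_rieszPressure_le`, with `‖1_{B(y,6)}w‖₃³ ≤ m ∫_{B(y,6)}|w|²`;
  far field: the two-centre oscillation bound `exists_ae_abs_rieszPressure_sub_near_sub_const_le`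
  (`…PressureFar`) and the uniformly local tail `lintegral_compl_ball_mul_powKer_le`, paired against
  `∫_{B(y,3)} |w| ≤ m |B₃|`.

HONEST FRAMING: slice-level harmonic analysis serving one registered stub of an open crux; nothing about
Navier–Stokes regularity is proved; no summit statement is proved by this file.
-/

noncomputable section

-- the summit-side namespace `Summit.NavierStokesRegularity.NavierStokesRegularity.…` (single-conjunct summit,
-- D-0017) repeats a component by design; the dupNamespace linter would flag every declaration.
set_option linter.dupNamespace false

namespace Summit.NavierStokesRegularity.NavierStokesRegularity.Theorems.ThinCascade

open MeasureTheory Set Function Metric Filter Topology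
open scoped ENNReal NNReal
open Literature.Analysis Literature.Analysis.FluidPDE

/-! ### Covering: balls of radius `6` by unit balls -/

/-- **Uniformly local energies control the energy of any `6`-ball**: there is a universal `N₆ < ∞`
with `∫_{B(y,6)} g ≤ N₆ · A` whenever `∫_{B(z,1)} g ≤ A` for all `z` (finite unit-ball cover of a
`6`-ball, uniform in the centre). [folklore] -/
theorem exists_lintegral_ball_six_le :
    ∃ N : ℝ≥0∞, N ≠ ⊤ ∧ ∀ (g : EuclideanSpace ℝ (Fin 3) → ℝ≥0∞) (A : ℝ≥0∞),
      (∀ z : EuclideanSpace ℝ (Fin 3), ∫⁻ x in ball z 1, g x ≤ A) →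
        ∀ y : EuclideanSpace ℝ (Fin 3), ∫⁻ x in ball y 6, g x ≤ N * A := by
  obtain ⟨F, hF⟩ := exists_finset_ball_subset_biUnion_ball_one (6 : ℝ)
  refine ⟨F.card, ENNReal.natCast_ne_top _, fun g A hA y => ?_⟩
  calc ∫⁻ x in ball y 6, g x ≤ ∫⁻ x in ⋃ c ∈ F, ball (y + c) 1, g x := lintegral_mono_set (hF y)
    _ ≤ F.card * A := lintegral_biUnion_finset_le_card_mul F (fun c => ball (y + c) 1) g
        fun c _ => hA (y + c)

/-! ### Elementary slice inequalities under a pointwise bound -/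

/-- `∫_{S} |w|³ ≤ m ∫_{S} |w|²` when `‖w‖ ≤ m` pointwise. [folklore] -/
theorem lintegral_cube_le_mul_sq {w : EuclideanSpace ℝ (Fin 3) → EuclideanSpace ℝ (Fin 3)} {m : ℝ}
    (hwm : ∀ x, ‖w x‖ ≤ m) (S : Set (EuclideanSpace ℝ (Fin 3))) :
    ∫⁻ x in S, ‖w x‖ₑ ^ (3 : ℕ) ≤ ENNReal.ofReal m * ∫⁻ x in S, ‖w x‖ₑ ^ 2 := by
  rw [← lintegral_const_mul' _ _ ENNReal.ofReal_ne_top]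
  refine lintegral_mono fun x => ?_
  have h1 : ‖w x‖ₑ ≤ ENNReal.ofReal m := by
    rw [← ofReal_norm]
    exact ENNReal.ofReal_le_ofReal (hwm x)
  calc ‖w x‖ₑ ^ (3 : ℕ) = ‖w x‖ₑ * ‖w x‖ₑ ^ 2 := by ring
    _ ≤ ENNReal.ofReal m * ‖w x‖ₑ ^ 2 := mul_le_mul' h1 le_rfl

/-- `∫_{S} |w| ≤ m |S|` when `‖w‖ ≤ m` pointwise. [folklore] -/
theorem lintegral_enorm_le_mul_volume {w : EuclideanSpace ℝ (Fin 3) → EuclideanSpace ℝ (Fin 3)}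
    {m : ℝ} (hwm : ∀ x, ‖w x‖ ≤ m) (S : Set (EuclideanSpace ℝ (Fin 3))) :
    ∫⁻ x in S, ‖w x‖ₑ ≤ ENNReal.ofReal m * volume S := by
  calc ∫⁻ x in S, ‖w x‖ₑ ≤ ∫⁻ _ in S, ENNReal.ofReal m := by
        refine lintegral_mono fun x => ?_
        rw [← ofReal_norm]
        exact ENNReal.ofReal_le_ofReal (hwm x)
    _ = ENNReal.ofReal m * volume S := by rw [lintegral_const, Measure.restrict_apply_univ]

/-! ### The near field: Hölder and Stein -/

/-- **The near-field pairing**: for `U₁ ∈ L³`,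
`∫ |Π[U₁]| |U₁| ≤ C_S ∫ |U₁|³` (Hölder `L^{3/2} × L³` and Stein's `‖Π[U₁]‖_{3/2} ≤ C_S ‖U₁‖₃²`).
[folklore] -/
theorem lintegral_rieszPressure_mul_le {U₁ : EuclideanSpace ℝ (Fin 3) → EuclideanSpace ℝ (Fin 3)}
    (hU₁ : MemLp U₁ 3 volume) :
    ∫⁻ x, ‖rieszPressure U₁ x‖ₑ * ‖U₁ x‖ₑ ≤
      (steinConstThreeHalves : ℝ≥0∞) * ∫⁻ x, ‖U₁ x‖ₑ ^ (3 : ℕ) := by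
  set I₃ : ℝ≥0∞ := ∫⁻ x, ‖U₁ x‖ₑ ^ (3 : ℕ) with hI₃
  have hPm := (memLp_rieszPressure hU₁).1
  have h32 : ((3 : ℝ≥0∞) / 2).toReal = 3 / 2 := by
    rw [ENNReal.toReal_div]; norm_num
  have hne32 : ((3 : ℝ≥0∞) / 2) ≠ ⊤ := ENNReal.div_ne_top (by norm_num) (by norm_num)
  -- Stein in lintegral form: `(∫ |Π|^{3/2})^{2/3} ≤ C_S I₃^{2/3}`
  have hS : (∫⁻ x, ‖rieszPressure U₁ x‖ₑ ^ (3 / 2 : ℝ)) ^ (2 / 3 : ℝ) ≤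
      (steinConstThreeHalves : ℝ≥0∞) * I₃ ^ (2 / 3 : ℝ) := by
    have h := eLpNorm_rieszPressure_le hU₁
    rw [eLpNorm_eq_lintegral_rpow_enorm_toReal (by norm_num) hne32, h32,
      show (1 / (3 / 2) : ℝ) = 2 / 3 by norm_num,
      eLpNorm_eq_lintegral_rpow_enorm_toReal (by norm_num) (by norm_num), ENNReal.toReal_ofNat,
      ← ENNReal.rpow_natCast, ← ENNReal.rpow_mul, show (1 / (3 : ℝ) * ((2 : ℕ) : ℝ)) = 2 / 3 by
        norm_num] at h
    have e3 : ∫⁻ x, ‖U₁ x‖ₑ ^ (3 : ℝ) = I₃ := by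
      rw [hI₃]
      refine lintegral_congr fun x => ?_
      rw [show (3 : ℝ) = ((3 : ℕ) : ℝ) by norm_num, ENNReal.rpow_natCast]
    rwa [e3] at h
  -- Hölder
  have hH := Literature.Analysis.FluidPDE.lintegral_mul_le_threeHalves_three volume
    hPm.enorm (hU₁.1.enorm)
  calc ∫⁻ x, ‖rieszPressure U₁ x‖ₑ * ‖U₁ x‖ₑ
      ≤ (∫⁻ x, ‖rieszPressure U₁ x‖ₑ ^ (3 / 2 : ℝ)) ^ (2 / 3 : ℝ) * I₃ ^ (1 / 3 : ℝ) := hH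
    _ ≤ (steinConstThreeHalves : ℝ≥0∞) * I₃ ^ (2 / 3 : ℝ) * I₃ ^ (1 / 3 : ℝ) :=
        mul_le_mul' hS le_rfl
    _ = (steinConstThreeHalves : ℝ≥0∞) * I₃ := by
        rw [mul_assoc, ← ENNReal.rpow_add_of_nonneg (2 / 3) (1 / 3) (by norm_num) (by norm_num),
          show (2 / 3 + 1 / 3 : ℝ) = 1 by norm_num, ENNReal.rpow_one]

/-- **The near field in `L^{3/2}`**, lintegral form: `∫ |Π[U₁]|^{3/2} ≤ C_S^{3/2} ∫ |U₁|³`.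
[folklore] -/
theorem lintegral_rieszPressure_rpow_le {U₁ : EuclideanSpace ℝ (Fin 3) → EuclideanSpace ℝ (Fin 3)}
    (hU₁ : MemLp U₁ 3 volume) :
    ∫⁻ x, ‖rieszPressure U₁ x‖ₑ ^ (3 / 2 : ℝ) ≤
      (steinConstThreeHalves : ℝ≥0∞) ^ (3 / 2 : ℝ) * ∫⁻ x, ‖U₁ x‖ₑ ^ (3 : ℕ) := by
  set I₃ : ℝ≥0∞ := ∫⁻ x, ‖U₁ x‖ₑ ^ (3 : ℕ) with hI₃
  have h32 : ((3 : ℝ≥0∞) / 2).toReal = 3 / 2 := by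
    rw [ENNReal.toReal_div]; norm_num
  have hne32 : ((3 : ℝ≥0∞) / 2) ≠ ⊤ := ENNReal.div_ne_top (by norm_num) (by norm_num)
  have h := eLpNorm_rieszPressure_le hU₁
  rw [eLpNorm_eq_lintegral_rpow_enorm_toReal (by norm_num) hne32, h32,
    eLpNorm_eq_lintegral_rpow_enorm_toReal (by norm_num) (by norm_num), ENNReal.toReal_ofNat,
    ← ENNReal.rpow_natCast, ← ENNReal.rpow_mul, show (1 / (3 : ℝ) * ((2 : ℕ) : ℝ)) = 2 / 3 by
      norm_num] at h
  have e3 : ∫⁻ x, ‖U₁ x‖ₑ ^ (3 : ℝ) = I₃ := by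
    rw [hI₃]
    refine lintegral_congr fun x => ?_
    rw [show (3 : ℝ) = ((3 : ℕ) : ℝ) by norm_num, ENNReal.rpow_natCast]
  rw [e3] at h
  -- raise `(∫ |Π|^{3/2})^{1/(3/2)} ≤ C_S I₃^{2/3}` to the power `3/2`
  have h' := ENNReal.rpow_le_rpow h (by norm_num : (0 : ℝ) ≤ 3 / 2)
  rw [← ENNReal.rpow_mul, show (1 / (3 / 2) * (3 / 2) : ℝ) = 1 by norm_num, ENNReal.rpow_one,
    ENNReal.mul_rpow_of_nonneg _ _ (by norm_num : (0 : ℝ) ≤ 3 / 2), ← ENNReal.rpow_mul,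
    show (2 / 3 * (3 / 2) : ℝ) = 1 by norm_num, ENNReal.rpow_one] at h'
  exact h'

/-! ### The far tail in real and in `ℝ≥0∞` form -/

/-- `ofReal (∫_{B(y,ρ)ᶜ} ‖w‖²/‖z−y‖⁴) = ∫⁻_{B(y,ρ)ᶜ} ‖w‖ₑ² · |z−y|⁻⁴` for `w ∈ L³`, `ρ > 0`. [folklore] -/
theorem ofReal_integral_far_weight_eq {w : EuclideanSpace ℝ (Fin 3) → EuclideanSpace ℝ (Fin 3)}
    (hw : MemLp w 3 volume) (y : EuclideanSpace ℝ (Fin 3)) {ρ : ℝ} (hρ : 0 < ρ) :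
    ENNReal.ofReal (∫ z in (ball y ρ)ᶜ, ‖w z‖ ^ 2 / ‖z - y‖ ^ 4) =
      ∫⁻ z in (ball y ρ)ᶜ, ‖w z‖ₑ ^ (2 : ℕ) * RieszKernel.powKer 4 (z - y) := by
  rw [ofReal_integral_eq_lintegral_ofReal (integrableOn_norm_sq_div_norm_sub_pow_four hw y hρ)
    (ae_of_all _ fun z => by positivity)]
  refine lintegral_congr fun z => ?_
  rw [RieszKernel.powKer_apply, ← inv_norm_pow_four_eq_rpow, div_eq_mul_inv,
    ENNReal.ofReal_mul (by positivity), ENNReal.ofReal_pow (norm_nonneg _), ofReal_norm]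

/-! ### The slice pressure bounds -/

/-- **The pressure on a time slice: uniformly local bounds linear in the local energy under a
pointwise bound.**  There is a universal `K < ∞` such that for every `w ∈ L³(ℝ³; ℝ³)` with
`‖w‖ ≤ m` pointwise (`m ≥ 0`) and unit-ball energies `∫_{B(z,1)} |w|² ≤ A` for all `z`, and every
centre `y`, there is a gauge `κ ∈ ℝ` with
`∫_{B(y,3)} |Π[w] − κ| · |w| ≤ K · m · A` and `∫_{B(y,3)} |Π[w] − κ|^{3/2} ≤ K · (m · A + A^{3/2})`,
`Π[w] = rieszPressure w`.  Near field `Π[1_{B(y,6)}w]` by Hölder–Stein with `|w|³ ≤ m|w|²`; far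
field `Π[w] − Π[1_{B(y,6)}w] − κ = O(∫_{B(y,6)ᶜ}|w|²|z−y|⁻⁴) = O(A)` on `B(y,3)` (two-centre bound and
uniformly local tail), paired against `∫_{B(y,3)}|w| ≤ m|B₃|`. [folklore] -/
theorem exists_slice_pressure_bounds :
    ∃ K : ℝ≥0∞, K ≠ ⊤ ∧ ∀ (w : EuclideanSpace ℝ (Fin 3) → EuclideanSpace ℝ (Fin 3)),
      MemLp w 3 volume → ∀ (m : ℝ), 0 ≤ m → (∀ x, ‖w x‖ ≤ m) → ∀ (A : ℝ≥0∞),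
        (∀ z : EuclideanSpace ℝ (Fin 3), ∫⁻ x in ball z 1, ‖w x‖ₑ ^ 2 ≤ A) →
        ∀ y : EuclideanSpace ℝ (Fin 3), ∃ κ : ℝ,
          (∫⁻ x in ball y 3, ‖rieszPressure w x - κ‖ₑ * ‖w x‖ₑ ≤ K * ENNReal.ofReal m * A) ∧
          (∫⁻ x in ball y 3, ‖rieszPressure w x - κ‖ₑ ^ (3 / 2 : ℝ) ≤
            K * (ENNReal.ofReal m * A + A ^ (3 / 2 : ℝ))) := by
  obtain ⟨N₆, hN₆top, hN₆⟩ := exists_lintegral_ball_six_le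
  obtain ⟨CK, hCK0, hCK⟩ := exists_ae_abs_rieszPressure_sub_near_sub_const_le
  -- universal constants
  set CS : ℝ≥0∞ := (steinConstThreeHalves : ℝ≥0∞) with hCS
  set V₁ : ℝ≥0∞ := volume (ball (0 : EuclideanSpace ℝ (Fin 3)) 1) with hV₁
  set V₃ : ℝ≥0∞ := volume (ball (0 : EuclideanSpace ℝ (Fin 3)) 3) with hV₃
  set K₅ : ℝ≥0∞ := ∫⁻ z in (ball (0 : EuclideanSpace ℝ (Fin 3)) (2 * 3 - 1))ᶜ, RieszKernel.powKer 4 z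
    with hK₅
  set Ctail : ℝ≥0∞ := V₁⁻¹ * (16 * K₅) with hCtail
  set cK : ℝ≥0∞ := ENNReal.ofReal (CK * 3) with hcK
  set K : ℝ≥0∞ := CS * N₆ + cK * Ctail * V₃ + (2 : ℝ≥0∞) ^ (1 / 2 : ℝ) *
    (CS ^ (3 / 2 : ℝ) * N₆ + (cK * Ctail) ^ (3 / 2 : ℝ) * V₃) with hK
  have hV₁0 : V₁ ≠ 0 := (measure_ball_pos volume _ one_pos).ne'
  have hV₁top : V₁ ≠ ⊤ := measure_ball_lt_top.ne
  have hV₃top : V₃ ≠ ⊤ := measure_ball_lt_top.ne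
  have hK₅top : K₅ ≠ ⊤ :=
    (RieszKernel.lintegral_compl_ball_powKer_lt_top (by norm_num : (3 : ℝ) < 4)
      (by norm_num : (0 : ℝ) < 2 * 3 - 1)).ne
  have hCtailtop : Ctail ≠ ⊤ :=
    ENNReal.mul_ne_top (ENNReal.inv_ne_top.2 hV₁0) (ENNReal.mul_ne_top (by norm_num) hK₅top)
  have hcKtop : cK ≠ ⊤ := ENNReal.ofReal_ne_top
  have hCStop : CS ≠ ⊤ := ENNReal.coe_ne_top
  have h2top : (2 : ℝ≥0∞) ^ (1 / 2 : ℝ) ≠ ⊤ :=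
    ENNReal.rpow_ne_top_of_nonneg (by norm_num) ENNReal.ofNat_ne_top
  have hKtop : K ≠ ⊤ := by
    rw [hK]
    refine ENNReal.add_ne_top.2 ⟨ENNReal.add_ne_top.2 ⟨ENNReal.mul_ne_top hCStop hN₆top,
      ENNReal.mul_ne_top (ENNReal.mul_ne_top hcKtop hCtailtop) hV₃top⟩, ENNReal.mul_ne_top h2top
      (ENNReal.add_ne_top.2 ⟨ENNReal.mul_ne_top (ENNReal.rpow_ne_top_of_nonneg (by norm_num)
        hCStop) hN₆top, ENNReal.mul_ne_top (ENNReal.rpow_ne_top_of_nonneg (by norm_num)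
        (ENNReal.mul_ne_top hcKtop hCtailtop)) hV₃top⟩)⟩
  refine ⟨K, hKtop, fun w hw m hm hwm A hA y => ?_⟩
  -- the near field and the far gauge
  set U₁ : EuclideanSpace ℝ (Fin 3) → EuclideanSpace ℝ (Fin 3) := (ball y (2 * 3)).indicator w with hU₁
  have hU₁3 : MemLp U₁ 3 volume := hw.indicator measurableSet_ball
  obtain ⟨κ, hκ⟩ := hCK w hw y 3 (by norm_num)
  refine ⟨κ, ?_⟩
  -- ## sizes
  -- `I₃ = ∫ |U₁|³ = ∫_{B(y,6)} |w|³ ≤ m N₆ A`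
  have hI₃eq : ∫⁻ x, ‖U₁ x‖ₑ ^ (3 : ℕ) = ∫⁻ x in ball y (2 * 3), ‖w x‖ₑ ^ (3 : ℕ) := by
    rw [← lintegral_indicator measurableSet_ball]
    refine lintegral_congr fun x => ?_
    simp only [hU₁]
    by_cases hx : x ∈ ball y (2 * 3)
    · rw [indicator_of_mem hx, indicator_of_mem hx]
    · rw [indicator_of_notMem hx, indicator_of_notMem hx, enorm_zero, zero_pow three_ne_zero]
  have hI₃ : ∫⁻ x, ‖U₁ x‖ₑ ^ (3 : ℕ) ≤ ENNReal.ofReal m * (N₆ * A) := by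
    rw [hI₃eq]
    refine (lintegral_cube_le_mul_sq hwm _).trans (mul_le_mul' le_rfl ?_)
    rw [show (2 * 3 : ℝ) = 6 by norm_num]
    exact hN₆ (fun x => ‖w x‖ₑ ^ 2) A hA y
  -- the far tail `W ≤ Ctail A`
  have hfar : ∫⁻ z in (ball y (2 * 3))ᶜ, ‖w z‖ₑ ^ (2 : ℕ) * RieszKernel.powKer 4 (z - y) ≤
      Ctail * A := by
    have h := lintegral_compl_ball_mul_powKer_le (hw.1.enorm.pow_const _) hA y
      (by norm_num : (2 : ℝ) ≤ 2 * 3)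
    rw [hCtail]
    calc _ ≤ V₁⁻¹ * (A * (16 * K₅)) := h
      _ = V₁⁻¹ * (16 * K₅) * A := by ring
  -- the far oscillation in `ℝ≥0∞`: a.e. on `B(y,3)`, `‖Π[w] − Π[U₁] − κ‖ₑ ≤ cK · Ctail · A`
  have hosc : ∀ᵐ x ∂(volume.restrict (ball y 3)),
      ‖rieszPressure w x - rieszPressure U₁ x - κ‖ₑ ≤ cK * (Ctail * A) := by
    filter_upwards [hκ] with x hx
    rw [Real.enorm_eq_ofReal_abs]
    calc ENNReal.ofReal |rieszPressure w x - rieszPressure U₁ x - κ|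
        ≤ ENNReal.ofReal (CK * 3 * ∫ z in (ball y (2 * 3))ᶜ, ‖w z‖ ^ 2 / ‖z - y‖ ^ 4) :=
          ENNReal.ofReal_le_ofReal hx
      _ = cK * ∫⁻ z in (ball y (2 * 3))ᶜ, ‖w z‖ₑ ^ (2 : ℕ) * RieszKernel.powKer 4 (z - y) := by
          rw [ENNReal.ofReal_mul (by positivity), hcK,
            ofReal_integral_far_weight_eq hw y (by norm_num)]
      _ ≤ cK * (Ctail * A) := mul_le_mul' le_rfl hfar
  -- pointwise splitting `‖Π[w] − κ‖ₑ ≤ ‖Π[U₁]‖ₑ + ‖Π[w] − Π[U₁] − κ‖ₑ`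
  have hsplit : ∀ x, ‖rieszPressure w x - κ‖ₑ ≤
      ‖rieszPressure U₁ x‖ₑ + ‖rieszPressure w x - rieszPressure U₁ x - κ‖ₑ := by
    intro x
    have e : rieszPressure w x - κ = rieszPressure U₁ x + (rieszPressure w x - rieszPressure U₁ x - κ) := by
      ring
    rw [e]
    exact enorm_add_le _ _
  have hmeasP : AEMeasurable (fun x => ‖rieszPressure U₁ x‖ₑ) (volume.restrict (ball y 3)) :=
    ((memLp_rieszPressure hU₁3).1.enorm).restrict
  have hmeasw : AEMeasurable (fun x => ‖w x‖ₑ) (volume.restrict (ball y 3)) := hw.1.enorm.restrict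
  have hV₃eq : volume (ball y 3) = V₃ := by rw [hV₃, Measure.addHaar_ball_center]
  -- `∫_{B(y,3)} |Π[U₁]| |w| ≤ ∫ |Π[U₁]| |U₁|` (on `B(y,3)`, `w = U₁`)
  have hnear_pair : ∫⁻ x in ball y 3, ‖rieszPressure U₁ x‖ₑ * ‖w x‖ₑ ≤
      ∫⁻ x, ‖rieszPressure U₁ x‖ₑ * ‖U₁ x‖ₑ := by
    calc ∫⁻ x in ball y 3, ‖rieszPressure U₁ x‖ₑ * ‖w x‖ₑ
        = ∫⁻ x in ball y 3, ‖rieszPressure U₁ x‖ₑ * ‖U₁ x‖ₑ := by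
          refine setLIntegral_congr_fun measurableSet_ball fun x hx => ?_
          simp only [hU₁]
          rw [indicator_of_mem (ball_subset_ball (by norm_num) hx)]
      _ ≤ ∫⁻ x, ‖rieszPressure U₁ x‖ₑ * ‖U₁ x‖ₑ := setLIntegral_le_lintegral _ _
  constructor
  · -- ## the pairing bound
    calc ∫⁻ x in ball y 3, ‖rieszPressure w x - κ‖ₑ * ‖w x‖ₑ
        ≤ ∫⁻ x in ball y 3, (‖rieszPressure U₁ x‖ₑ + cK * (Ctail * A)) * ‖w x‖ₑ := by
          refine lintegral_mono_ae ?_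
          filter_upwards [hosc] with x hx
          exact mul_le_mul' ((hsplit x).trans (add_le_add le_rfl hx)) le_rfl
      _ = (∫⁻ x in ball y 3, ‖rieszPressure U₁ x‖ₑ * ‖w x‖ₑ) +
            cK * (Ctail * A) * ∫⁻ x in ball y 3, ‖w x‖ₑ := by
          have hfm : AEMeasurable (fun x => ‖rieszPressure U₁ x‖ₑ * ‖w x‖ₑ)
              (volume.restrict (ball y 3)) := hmeasP.mul hmeasw
          simp_rw [add_mul]
          rw [lintegral_add_left' hfm, lintegral_const_mul'' _ hmeasw]
      _ ≤ CS * (ENNReal.ofReal m * (N₆ * A)) + cK * (Ctail * A) * (ENNReal.ofReal m * V₃) := by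
          gcongr
          · exact hnear_pair.trans ((lintegral_rieszPressure_mul_le hU₁3).trans
              (mul_le_mul' le_rfl hI₃))
          · rw [← hV₃eq]
            exact lintegral_enorm_le_mul_volume hwm _
      _ = (CS * N₆ + cK * Ctail * V₃) * ENNReal.ofReal m * A := by ring
      _ ≤ K * ENNReal.ofReal m * A := by
          gcongr
          rw [hK]
          exact le_self_add
  · -- ## the `L^{3/2}` bound
    have hF : ∀ᵐ x ∂(volume.restrict (ball y 3)), ‖rieszPressure w x - κ‖ₑ ^ (3 / 2 : ℝ) ≤
        (2 : ℝ≥0∞) ^ (1 / 2 : ℝ) * (‖rieszPressure U₁ x‖ₑ ^ (3 / 2 : ℝ) +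
          (cK * (Ctail * A)) ^ (3 / 2 : ℝ)) := by
      filter_upwards [hosc] with x hx
      calc ‖rieszPressure w x - κ‖ₑ ^ (3 / 2 : ℝ)
          ≤ (‖rieszPressure U₁ x‖ₑ + cK * (Ctail * A)) ^ (3 / 2 : ℝ) :=
            ENNReal.rpow_le_rpow ((hsplit x).trans (add_le_add le_rfl hx)) (by norm_num)
        _ ≤ _ := add_rpow_threeHalves_le _ _
    calc ∫⁻ x in ball y 3, ‖rieszPressure w x - κ‖ₑ ^ (3 / 2 : ℝ)
        ≤ ∫⁻ x in ball y 3, (2 : ℝ≥0∞) ^ (1 / 2 : ℝ) * (‖rieszPressure U₁ x‖ₑ ^ (3 / 2 : ℝ) +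
            (cK * (Ctail * A)) ^ (3 / 2 : ℝ)) := lintegral_mono_ae hF
      _ = (2 : ℝ≥0∞) ^ (1 / 2 : ℝ) * ((∫⁻ x in ball y 3, ‖rieszPressure U₁ x‖ₑ ^ (3 / 2 : ℝ)) +
            (cK * (Ctail * A)) ^ (3 / 2 : ℝ) * volume (ball y 3)) := by
          rw [lintegral_const_mul' _ _ h2top, lintegral_add_left' (hmeasP.pow_const _),
            lintegral_const, Measure.restrict_apply_univ]
      _ ≤ (2 : ℝ≥0∞) ^ (1 / 2 : ℝ) * (CS ^ (3 / 2 : ℝ) * (ENNReal.ofReal m * (N₆ * A)) +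
            (cK * Ctail) ^ (3 / 2 : ℝ) * A ^ (3 / 2 : ℝ) * V₃) := by
          rw [hV₃eq]
          gcongr
          · exact (setLIntegral_le_lintegral _ _).trans
              ((lintegral_rieszPressure_rpow_le hU₁3).trans (mul_le_mul' le_rfl hI₃))
          · rw [← mul_assoc, ENNReal.mul_rpow_of_nonneg _ _ (by norm_num : (0 : ℝ) ≤ 3 / 2)]
      _ = (2 : ℝ≥0∞) ^ (1 / 2 : ℝ) * (CS ^ (3 / 2 : ℝ) * N₆) * (ENNReal.ofReal m * A) +
            (2 : ℝ≥0∞) ^ (1 / 2 : ℝ) * ((cK * Ctail) ^ (3 / 2 : ℝ) * V₃) * A ^ (3 / 2 : ℝ) := by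
          ring
      _ ≤ K * (ENNReal.ofReal m * A) + K * A ^ (3 / 2 : ℝ) := by
          gcongr
          · rw [hK, mul_add]
            exact le_add_left le_self_add
          · rw [hK, mul_add]
            exact le_add_left le_add_self
      _ = K * (ENNReal.ofReal m * A + A ^ (3 / 2 : ℝ)) := by ring

end Summit.NavierStokesRegularity.NavierStokesRegularity.Theorems.ThinCascade

end
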